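import Summits.ABC.IUTFork.Joshi.ArithHolStructureTiltRoots
import HarnessLib

/-!
# FUNCTORIALITY of the tilt in ISOMETRIC isomorphisms of untilts — `K ≅ K′ ⟹ K♭ ≅ K′♭` isometrically — and Def. 4.1.1's
# «morphisms of the data» WITH the tilting datum (MODEL / SUPPLY over p442777 … p453124; closes p431050 reading note (a))

Block E (rung LADDER-ABC:A2.E), seat abc-iut-E-t10 (gen 4). [J-I] = Joshi, arXiv:2106.11452v4, Def. 4.1.1 p.18 l.20–22 «morphisms …
of the data (X/E, (K ⊃ E, K♭ ≃ F), ∗_K)»: p431050 typed `ArithHolStructure.Iso` WITHOUT the tilt component — reading note (a): «tilt-iso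
compatibility NOT recorded (Mathlib has no functoriality of `Tilt` in field isomorphisms) — WEAKER-THAN-PRINT on that component, flagged».
THIS FILE SUPPLIES THE FUNCTORIALITY, hypothesis-free, for every ISOMETRIC field isomorphism `φ : K ≃ K′` of untilts (E-t1's `Untilt p`):
* `intMap φ : 𝒪_K ≃+* 𝒪_{K′}`, `modPMap φ : 𝒪_K/p ≃+* 𝒪_{K′}/p` (`Ideal.quotientEquiv`), `preTiltMap φ : (𝒪_K/p)^perf ≃+* (𝒪_{K′}/p)^perf`
  (Mathlib `Perfection.map` both ways);
* **`flatInt_preTiltMap`**: the Teichmüller TOWERS correspond — `(preTiltMap φ f)^{♯,1/pⁿ} = φ (f^{♯,1/pⁿ})` (via p452609's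
  `coeff_eq_mk_towerInt` and p442777's `ofSeq`/`flatInt_ofSeq`; no limit argument); hence `teichmuller_preTiltMap` (naturality of Mathlib's
  `teichmuller₀`) and **`valInt_preTiltMap` : `|preTiltMap φ f|_♭′ = |f|_♭`**;
* `tiltMapFr φ : K♭ ≃+* K′♭` (`IsFractionRing.ringEquivOfRingEquiv`), **`valFr_tiltMapFr` / `norm_tiltMapFr`: an ISOMETRY for `‖·‖_♭`**;
  hypothesis-free on `ATS1.tilt`: **`tiltMap φ : tilt U ≃+* tilt U′`**, `norm_tiltMap`;
* **`ArithHolStructure.IsoTilt`**: p431050's `Iso` (topological field iso + embeddings + base points) TOGETHER WITH the isometry of the field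
  isomorphism and the commutation of the two tilting data through the induced `tiltMap` — Def. 4.1.1's «morphisms of the data
  (K ⊃ E, K♭ ≃ F)» with the tilt component, the upgrade reading note (a) asked for; `IsoTilt.isIso`, `IsoTilt.norm_tiltIso_comm`.
All [folklore] (functoriality of [Scholze 2012, Lem. 3.4]'s construction); no claim of Joshi's used or asserted; no `Prop` hypothesis,
instance, notation or FACT-LIST row. HONEST SCOPE: isometric `φ` only (a merely HOMEOMORPHIC field iso of untilts is a dilated isometry
`‖φ x‖ = ‖x‖^s`, E-t55/E-t16 `topIso_iff_exists_norm_rpow` p438930, and induces `K♭ ≅ K′♭` the same way with `|·|_♭′ = |·|_♭^s`; not typed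
here). No side taken on [IUTchIII] Cor. 3.12 or on any author. bears_on: LADDER-ABC:A2.E.
-/

noncomputable section

open scoped NNReal

namespace Summit.ABC.IUTFork.Joshi.ATS1

open Summit.ABC.IUTFork.Joshi

variable {p : ℕ} [Fact p.Prime]

namespace TiltModel

/-! ## 1. `𝒪_K ≅ 𝒪_{K′}` and `𝒪_K/p ≅ 𝒪_{K′}/p` along an isometric `φ : K ≅ K′` -/

section Rings

variable {U U' : Untilt p} (φ : U.K ≃+* U'.K) (hφ : ∀ x, ‖φ x‖ = ‖x‖)

/-- An isometric field isomorphism of untilts restricts to the valuation rings `𝒪_K ≃+* 𝒪_{K′}`. [folklore] -/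
def intMap : int U ≃+* int U' where
  toFun x := ⟨φ x, (mem_int_iff U').2 (by rw [hφ]; exact (mem_int_iff U).1 x.2)⟩
  invFun y := ⟨φ.symm y, (mem_int_iff U).2 (by rw [← hφ, RingEquiv.apply_symm_apply]; exact (mem_int_iff U').1 y.2)⟩
  left_inv x := Subtype.ext (φ.symm_apply_apply (x : U.K))
  right_inv y := Subtype.ext (φ.apply_symm_apply (y : U'.K))
  map_mul' x y := Subtype.ext (map_mul φ (x : U.K) (y : U.K))
  map_add' x y := Subtype.ext (map_add φ (x : U.K) (y : U.K))

/-- `intMap φ x = φ x` in `K′`. [folklore] -/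
theorem coe_intMap (x : int U) : ((intMap φ hφ x : int U') : U'.K) = φ x := rfl

/-- `intMap φ` carries `(p) ⊂ 𝒪_K` onto `(p) ⊂ 𝒪_{K′}`. [folklore] -/
theorem map_span_p : Ideal.map (intMap φ hφ) (Ideal.span {((p : ℕ) : int U)}) = Ideal.span {((p : ℕ) : int U')} := by
  rw [Ideal.map_span, Set.image_singleton, map_natCast]

variable [Fact (¬ IsUnit ((p : ℕ) : int U))] [Fact (¬ IsUnit ((p : ℕ) : int U'))]

/-- … hence `𝒪_K/p ≃+* 𝒪_{K′}/p`. [folklore] -/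
def modPMap : ModP (int U) p ≃+* ModP (int U') p :=
  Ideal.quotientEquiv _ _ (intMap φ hφ) (map_span_p φ hφ).symm

omit [Fact (¬ IsUnit ((p : ℕ) : int U))] [Fact (¬ IsUnit ((p : ℕ) : int U'))] in
/-- `modPMap φ (a mod p) = φ a mod p`. [folklore] -/
theorem modPMap_mk (a : int U) : modPMap φ hφ (Ideal.Quotient.mk _ a) = Ideal.Quotient.mk _ (intMap φ hφ a) :=
  Ideal.quotientEquiv_mk _ _ _ _ a

/-! ## 2. `(𝒪_K/p)^perf ≅ (𝒪_{K′}/p)^perf`; the Teichmüller towers correspond; `|·|_♭` is preserved -/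

/-- **`preTiltMap φ : 𝒪_{K♭} ≃+* 𝒪_{K′♭}`** — Mathlib's `Perfection.map` of `modPMap φ` and of its inverse. [folklore] -/
def preTiltMap : PreTilt (int U) p ≃+* PreTilt (int U') p where
  toFun f := Perfection.map p ((modPMap φ hφ : ModP (int U) p ≃+* ModP (int U') p) : ModP (int U) p →+* ModP (int U') p) f
  invFun g := Perfection.map p ((modPMap φ hφ).symm : ModP (int U') p →+* ModP (int U) p) g
  left_inv f := Perfection.ext fun n => by simp [Perfection.coeff_map]
  right_inv g := Perfection.ext fun n => by simp [Perfection.coeff_map]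
  map_mul' f g := map_mul _ f g
  map_add' f g := map_add _ f g

/-- Coefficients: `(preTiltMap φ f)_n = modPMap φ (f_n)`. [folklore] -/
theorem coeff_preTiltMap (f : PreTilt (int U) p) (n : ℕ) : PreTilt.coeff n (preTiltMap φ hφ f) = modPMap φ hφ (PreTilt.coeff n f) :=
  rfl

variable [IsAdicComplete (Ideal.span {((p : ℕ) : int U)}) (int U)] [IsAdicComplete (Ideal.span {((p : ℕ) : int U')}) (int U')]

/-- **The Teichmüller towers correspond**: `flatInt (preTiltMap φ f) = φ ∘ flatInt f` coordinatewise (p433682's `seqMap`). PROVED by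
comparing coefficients (`f_n = f^{♯,1/pⁿ} mod p`, p452609 `coeff_eq_mk_towerInt`) with the reduced tower `ofSeq (φ ∘ flatInt f)` (p442777)
— no limits. [folklore] -/
theorem flatInt_preTiltMap (f : PreTilt (int U) p) : flatInt U' (preTiltMap φ hφ f) = seqMap φ (flatInt U f) := by
  have hx : seqMap φ (flatInt U f) ∈ powerCompatSeq U' := seqMap_mem φ (flatInt_mem U f)
  have h0 : ‖seqMap φ (flatInt U f) 0‖ ≤ 1 := by
    show ‖φ (flatInt U f 0)‖ ≤ 1
    rw [hφ, flatInt_apply_zero]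
    exact norm_coe_le_one _
  have heq : preTiltMap φ hφ f = ofSeq U' (seqMap φ (flatInt U f)) hx h0 := by
    refine Perfection.ext fun n => ?_
    rw [show Perfection.coeff _ p n (preTiltMap φ hφ f) = PreTilt.coeff n (preTiltMap φ hφ f) from rfl, coeff_preTiltMap,
      coeff_eq_mk_towerInt, modPMap_mk]
    show _ = PreTilt.coeff n (Perfection.quotientMulEquiv p (Ideal.span {((p : ℕ) : int U')}) (toPerfection U' _ hx h0))
    rw [PreTilt.coeff_def, Perfection.coeff_quotientMulEquiv]
    rfl
  rw [heq, flatInt_ofSeq]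

/-- **Naturality of Mathlib's Teichmüller map**: `(preTiltMap φ f)^♯ = φ (f^♯)` in `𝒪_{K′}`. [folklore] -/
theorem teichmuller_preTiltMap (f : PreTilt (int U) p) :
    Perfection.teichmuller₀ p (Ideal.span {((p : ℕ) : int U')}) (preTiltMap φ hφ f) =
      intMap φ hφ (Perfection.teichmuller₀ p (Ideal.span {((p : ℕ) : int U)}) f) := by
  apply Subtype.ext
  rw [← flatInt_apply_zero, flatInt_preTiltMap, coe_intMap, ← flatInt_apply_zero]
  rfl

/-- **`|preTiltMap φ f|_♭′ = |f|_♭`**. [folklore] -/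
theorem valInt_preTiltMap (f : PreTilt (int U) p) : valInt U' (preTiltMap φ hφ f) = valInt U f := by
  rw [valInt_eq_nnnorm, valInt_eq_nnnorm, flatInt_preTiltMap]
  apply NNReal.eq
  rw [coe_nnnorm, coe_nnnorm]
  exact hφ _

/-! ## 3. `K♭ ≅ K′♭` on the fraction fields, isometrically -/

variable [IsDomain (PreTilt (int U) p)] [IsDomain (PreTilt (int U') p)]

/-- **`tiltMapFr φ : K♭ ≃+* K′♭`** (fraction-field presentation; Mathlib `IsFractionRing.ringEquivOfRingEquiv` of `preTiltMap φ`). [folklore] -/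
def tiltMapFr : tiltFr U ≃+* tiltFr U' := IsFractionRing.ringEquivOfRingEquiv (preTiltMap φ hφ)

omit [IsAdicComplete (Ideal.span {((p : ℕ) : int U)}) (int U)] [IsAdicComplete (Ideal.span {((p : ℕ) : int U')}) (int U')]
  [IsDomain (PreTilt (int U) p)] [IsDomain (PreTilt (int U') p)] in
/-- `tiltMapFr` on integral elements. [folklore] -/
theorem tiltMapFr_algebraMap (a : PreTilt (int U) p) :
    tiltMapFr φ hφ (algebraMap _ (tiltFr U) a) = algebraMap _ (tiltFr U') (preTiltMap φ hφ a) :=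
  IsFractionRing.ringEquivOfRingEquiv_algebraMap _ a

/-- **`|tiltMapFr φ z|_♭′ = |z|_♭`**: the induced isomorphism of tilts is an ISOMETRY. PROVED. [folklore] -/
theorem valFr_tiltMapFr (z : tiltFr U) : valFr U' (tiltMapFr φ hφ z) = valFr U z := by
  obtain ⟨⟨a, s⟩, rfl⟩ := IsLocalization.mk'_surjective (nonZeroDivisors (PreTilt (int U) p)) z
  show valFr U' (tiltMapFr φ hφ (IsLocalization.mk' (tiltFr U) a s)) = valFr U (IsLocalization.mk' (tiltFr U) a s)
  rw [IsFractionRing.mk'_eq_div, map_div₀, tiltMapFr_algebraMap, tiltMapFr_algebraMap, map_div₀, map_div₀, valFr_algebraMap,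
    valFr_algebraMap, valFr_algebraMap, valFr_algebraMap, valInt_preTiltMap, valInt_preTiltMap]

/-- … the same in the norms of the normed fields `(K♭, ‖·‖_♭)`, `(K′♭, ‖·‖_♭′)` (p442777 `normedFieldFr`). [folklore] -/
theorem norm_tiltMapFr (z : tiltFr U) : (letI := normedFieldFr U'; ‖tiltMapFr φ hφ z‖) = (letI := normedFieldFr U; ‖z‖) := by
  rw [norm_eq_valFr, norm_eq_valFr, valFr_tiltMapFr]

end Rings

/-! ## 4. On `ATS1.tilt`, hypothesis-free -/

/-- **`K ≅ K′` isometrically ⟹ `K♭ ≅ K′♭`**: the tilt is FUNCTORIAL in isometric isomorphisms of untilts — an explicit field isomorphism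
`ATS1.tilt U ≃+* ATS1.tilt U′` for every isometric `φ : U.K ≃+* U′.K`, no hypotheses (the missing functoriality of p431050 reading note (a)).
CONSTRUCTED. [folklore] -/
def tiltMap {U U' : Untilt p} (φ : U.K ≃+* U'.K) (hφ : ∀ x, ‖φ x‖ = ‖x‖) : tilt U ≃+* tilt U' :=
  haveI : Fact (¬ IsUnit ((p : ℕ) : int U)) := ⟨not_isUnit_p U⟩
  haveI : Fact (¬ IsUnit ((p : ℕ) : int U')) := ⟨not_isUnit_p U'⟩
  haveI : IsDomain (PreTilt (int U) p) := isDomain_preTilt U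
  haveI : IsDomain (PreTilt (int U') p) := isDomain_preTilt U'
  haveI : IsAdicComplete (Ideal.span {((p : ℕ) : int U)}) (int U) := isAdicComplete_int U
  haveI : IsAdicComplete (Ideal.span {((p : ℕ) : int U')}) (int U') := isAdicComplete_int U'
  tiltMapFr φ hφ

/-- **… and it is an ISOMETRY for `‖·‖_♭`** (`normedFieldTilt`, p442777). PROVED. [folklore] -/
theorem norm_tiltMap {U U' : Untilt p} (φ : U.K ≃+* U'.K) (hφ : ∀ x, ‖φ x‖ = ‖x‖) (z : tilt U) :
    (letI := normedFieldTilt U'; ‖tiltMap φ hφ z‖) = (letI := normedFieldTilt U; ‖z‖) :=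
  haveI : Fact (¬ IsUnit ((p : ℕ) : int U)) := ⟨not_isUnit_p U⟩
  haveI : Fact (¬ IsUnit ((p : ℕ) : int U')) := ⟨not_isUnit_p U'⟩
  haveI : IsDomain (PreTilt (int U) p) := isDomain_preTilt U
  haveI : IsDomain (PreTilt (int U') p) := isDomain_preTilt U'
  haveI : IsAdicComplete (Ideal.span {((p : ℕ) : int U)}) (int U) := isAdicComplete_int U
  haveI : IsAdicComplete (Ideal.span {((p : ℕ) : int U')}) (int U') := isAdicComplete_int U'
  norm_tiltMapFr φ hφ z

end TiltModel

/-! ## 5. Def. 4.1.1 «morphisms of the data (K ⊃ E, K♭ ≃ F)» WITH the tilt component -/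

namespace ArithHolStructure

open TiltModel

variable {X : Literature.AnabelianGeometry.SemiGraphs.TemperedCurve p} {A : BerkovichDatum X} {F : Type} [NormedField F]
  [CompleteSpace F] [IsUltrametricDist F] [IsAlgClosed F] [CharP F p]

/-- **Isomorphisms of arithmetic holomorphic structures COMPATIBLE WITH THE TILTING DATA** ([J-I] Def. 4.1.1 p.18 l.20–22 «morphisms
… of the data (X/E, (K ⊃ E, K♭ ≃ F), ∗_K)»): p431050's `Iso` (topological field isomorphism `K ≅ K′` compatible with `E ↪ K`, `E ↪ K′`
and the base points) TOGETHER WITH (i) the isometry of the field isomorphism and (ii) the commutation of the two tilting data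
`ι : K♭ ≃ F`, `ι′ : K′♭ ≃ F` through the induced isomorphism of tilts `tiltMap` — the component reading note (a) of p431050 could not
record. [claim: Joshi2021ATS1, status: disputed] -/
structure IsoTilt (S S' : ArithHolStructure X A F) extends Iso S S' where
  /-- `K ≅ K′` is an isometry -/
  norm_map : ∀ x, ‖fieldEquiv.toRingEquiv x‖ = ‖x‖
  /-- `ι′ ∘ (φ)_♭ = ι`: the tilting data correspond under the induced isomorphism of tilts -/
  tilt_comm : ∀ z, S'.tiltIso (tiltMap fieldEquiv.toRingEquiv norm_map z) = S.tiltIso z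

/-- A tilt-compatible isomorphism is in particular an isomorphism in p431050's sense. [folklore] -/
theorem IsoTilt.isIso {S S' : ArithHolStructure X A F} (e : IsoTilt S S') : S.IsIso S' := ⟨e.toIso⟩

/-- Under a tilt-compatible isomorphism the composite `ι′⁻¹ ∘ ι : K♭ ≅ K′♭` IS the induced map of tilts, hence an isometry for `‖·‖_♭`:
`‖ι′⁻¹ (ι z)‖_♭′ = ‖z‖_♭`. PROVED. [folklore] -/
theorem IsoTilt.norm_tiltIso_comm {S S' : ArithHolStructure X A F} (e : IsoTilt S S') (z : tilt S.U) :
    (letI := normedFieldTilt S'.U; ‖S'.tiltIso.symm (S.tiltIso z)‖) = (letI := normedFieldTilt S.U; ‖z‖) := by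
  rw [← e.tilt_comm z, RingEquiv.symm_apply_apply]
  exact norm_tiltMap _ _ z

end ArithHolStructure

end Summit.ABC.IUTFork.Joshi.ATS1

end
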